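/-
Copyright (c) 2026 the pub-hodgecm-mathlib formalisation cell (harness21).  Prover seat hodgecm-mathlib-K2Liu-p05 (g2), 2026-09-04
(Track B «K2-LIT», crux hLiu418 = stmt-HodgeConjecture-24832, organ (L24-a) of socket #24i∕#30i `sig_K2LiuThetaTypeSphericalEigenvalueInert`,
LEAD F0P6-plan (g11) RULING «M-155g» (ii)).
-/
import Summits.HodgeConjecture.HodgeConjecture.Theorems.K2LiuInertWeilSphericalLine     -- ★ (this seat) §1–§2: the line from expansion off the self-dual box
import Literature.NumberTheory.Automorphic.UnitaryGroupIsotropicRootSymplectic            -- ★ `localRootElt`, `localRootNil`, `iota_localRootElt_apply`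
import Literature.NumberTheory.Automorphic.UnitaryGroupLocalExpansionNonsplit            -- ★ `ofSymplectic_f_sub_eq` (the Heisenberg phase of a move)
import HarnessLib

/-!
# (L24-a), geometric half: EXPANSION OFF THE SELF-DUAL BOX from the isotropic root elements of `K`, and the line `ω_v^K = ℂ · 1_{𝒪_vᴺ}`
# from root data (ISO)

Topic: crux hLiu418 (stmt-HodgeConjecture-24832), Track B «K2-LIT», socket #24i∕#30i `sig_K2LiuThetaTypeSphericalEigenvalueInert`, organ (L24-a)
(LEAD F0P6-plan (g11) RULING «M-155g» (ii)).  Sequel of ★ `Theorems/K2LiuInertWeilSphericalLine.lean` (the ENGINE run: `ω_v^K ⊆ ℂ · 1_{𝒪_vᴺ}` as soon as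
`K` expands every vector off the self-dual box `Λ₀ = 𝒪_vᴺ × 𝒪_vᴺ`).  Namespace `Summit.HodgeConjecture.HodgeConjecture.Cruxes.HLiu418.K2LiuInertWeilSphericalLine`
(continued).  THEOREMS ONLY (no definition, no named fact, no instance, no notation, no `sorry`); `--supports stmt-HodgeConjecture-24832 --as helper`;
count-neutral.

THE MATHEMATICS ([MoeglinVignerasWaldspurger1987, Chap. 2 II.8, Chap. 5 I.4], [Howe1979, §2]).  `𝕎_v = F_vᴺ × F_vᴺ`, `B = polar β_{𝕋_v}`, `A = alt B`,
`ψ_v = adeleAddCharAt F v` of conductor `𝒪_v`, `v ∤ 2`, `𝕋_v` `v`-integral.  For an ISOTROPIC `r ∈ E_vᴺ` the tree has the root elements `n_{bδ}(r) ∈ U(J)(F_v)`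
(★ `localRootElt`), their symplectic images `ι_v(n_{bδ}(r)) = 1 + b 𝔫_r` (★ `iota_localRootElt_apply`, `𝔫_r = localRootNil r`, `𝔫_r² = 0`) and
`A(x, 𝔫_r x) = Nm_{E_v∕F_v} h(r, x)` (★ `alt_polar_localRootNil_self`).  HYPOTHESIS (ISO) on `K ≤ U(J)(F_v)`: every PRIMITIVE box vector
`u ∈ Λ₀ ∖ (𝔭ᴺ × 𝔭ᴺ)` admits an isotropic `r` with `n_{bδ}(r) ∈ K` for `b ∈ 𝒪_v`, `𝔫_r Λ₀ ⊆ Λ₀`, and `A(u, 𝔫_r u)` a `v`-unit.  CLAIM (§3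
`expansion_box_of_isotropicRoots`): then `K` EXPANDS OFF `Λ₀` — every `w ∉ Λ₀` is `ϖ^{-m} u` (`m ≥ 1`, `u` primitive: §3 `exists_pow_smul_mem_box_primitive`),
and `k = n_{bδ}(r)` with `b = -2 t₀ ϖ^{2m} ∕ A(u, 𝔫_r u)` (`t₀ ∈ 𝔭⁻¹`, `ψ_v(t₀) ≠ 1`) moves `w` by `y = b 𝔫_r w = -(2t₀ϖ^m∕A(u,𝔫_r u)) 𝔫_r u ∈ Λ₀` with Heisenberg
phase `½ A(y, w) + ½ B(y, y) = t₀ + ½ B(y, y)` (★ `ofSymplectic_f_sub_eq`), `½ B(y, y) ∈ 𝒪_v`, so `ψ_v(phase) = ψ_v(t₀) ≠ 1`.  §4 composes with the engine run: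
`ω_v^K = ℂ · 1_{𝒪_vᴺ}` and the line bound for the `χ`-coinvariants (the local θ-factor) FROM (ISO).  (ISO) itself is supplied at an inert good place `v` of a
rank-`2` form by an `𝒪_v`-adapted hyperbolic pair (sequel).

HONEST LABEL: HC_CM is proved only modulo the 7 printed citations (2 remaining named inputs: hLiu418 = stmt-HodgeConjecture-24832, h413 =
stmt-HodgeConjecture-24833) until rung 0 closes; count-neutral helper toward #24i, closes nothing.

## References
* [MoeglinVignerasWaldspurger1987] C. Mœglin, M.-F. Vignéras, J.-L. Waldspurger, LNM 1291 (1987), Chap. 1 I.17, Chap. 2 II.8, Chap. 5 I.4, I.11.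
* [Howe1979] R. Howe, *θ-series and invariant theory*, Proc. Symp. Pure Math. 33.1 (1979) 275–285, §2.
* [WeilBNT1967] A. Weil, *Basic Number Theory* (1967), Chap. II §2 (lattices and boxes over local fields).
* [Dieudonne1971GroupesClassiques] J. Dieudonné, *La géométrie des groupes classiques* (1971), Chap. II §5 (transvections of unitary groups).
-/

set_option autoImplicit false
set_option linter.dupNamespace false

noncomputable section

open NumberField IsDedekindDomain MeasureTheory
open scoped Matrix
open Literature.RepresentationTheory.HeisenbergGroup
open Literature.NumberTheory.Automorphic
open Literature.NumberTheory.GelbartRogawski1991.UnitaryDualPair.LocalSplitting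

namespace Summit.HodgeConjecture.HodgeConjecture.Cruxes.HLiu418.K2LiuInertWeilSphericalLine

/-! ## §3 Geometry: EXPANSION OFF THE SELF-DUAL BOX from isotropic root elements of `K` -/

section Expansion

open scoped NNReal
open Literature.NumberTheory.GaloisRepresentations.IsNonarchimedeanLocalField
open Literature.NumberTheory.Automorphic.UnitaryGroup

variable {F : Type} [Field F] [NumberField F] (E : Type) [Field E] [NumberField E] [Algebra F E]
  [Algebra.IsQuadraticExtension F E] (c : E ≃ₐ[F] E) (N : ℕ) {δ : E} (hcδ : c δ = -δ) (hδ : δ ≠ 0) {d : F}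
  (hd : δ * δ = algebraMap F E d) (T : Matrix (Fin N) (Fin N) F) (hT : T.IsSymm)
  {J : Matrix (Fin N) (Fin N) E} (hJ : J = T.map (algebraMap F E)) (hJh : (J.map c)ᵀ = J)
  (v : HeightOneSpectrum (𝓞 F))

/-- scalars of `𝔭^a` move the box `(𝔭^b)ᴺ × (𝔭^b)ᴺ` into the box `(𝔭^{a+b})ᴺ × (𝔭^{a+b})ᴺ`. [cite: WeilBNT1967, Ch. II §2, Def. 2] -/
theorem smul_mem_box_prod {a b : ℤ} {t : v.adicCompletion F} (ht : t ∈ primePowBall (v.adicCompletion F) a)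
    {x : (Fin N → v.adicCompletion F) × (Fin N → v.adicCompletion F)}
    (hx : x ∈ piPrimePowBall (v.adicCompletion F) (Fin N) b ×ˢ piPrimePowBall (v.adicCompletion F) (Fin N) b) :
    t • x ∈ piPrimePowBall (v.adicCompletion F) (Fin N) (a + b) ×ˢ piPrimePowBall (v.adicCompletion F) (Fin N) (a + b) := by
  refine ⟨(mem_piPrimePowBall_iff).2 fun i => ?_, (mem_piPrimePowBall_iff).2 fun i => ?_⟩
  · rw [Prod.smul_fst, Pi.smul_apply, smul_eq_mul]
    exact mul_mem_primePowBall ht ((mem_piPrimePowBall_iff).1 hx.1 i)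
  · rw [Prod.smul_snd, Pi.smul_apply, smul_eq_mul]
    exact mul_mem_primePowBall ht ((mem_piPrimePowBall_iff).1 hx.2 i)

/-- **primitive scaling**: every `w` off the self-dual box `Λ₀ = 𝒪_vᴺ × 𝒪_vᴺ` is `ϖ^{-m} u` with `m ≥ 1` and `u ∈ Λ₀` PRIMITIVE (not in
`𝔭_vᴺ × 𝔭_vᴺ`), for a uniformizer `ϖ` (`‖ϖ‖ = q_v⁻¹`): `m` is the least exponent with `ϖ^m w ∈ Λ₀`. [cite: WeilBNT1967, Ch. II §2, Prop. 4] -/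
theorem exists_pow_smul_mem_box_primitive {ϖ : v.adicCompletion F}
    (hϖ : normAbs (v.adicCompletion F) ϖ = (residueFieldCard (v.adicCompletion F) : ℝ≥0)⁻¹)
    (w : (Fin N → v.adicCompletion F) × (Fin N → v.adicCompletion F))
    (hw : w ∉ piPrimePowBall (v.adicCompletion F) (Fin N) 0 ×ˢ piPrimePowBall (v.adicCompletion F) (Fin N) 0) :
    ∃ m : ℕ, 1 ≤ m ∧ ϖ ^ m • w ∈ piPrimePowBall (v.adicCompletion F) (Fin N) 0 ×ˢ piPrimePowBall (v.adicCompletion F) (Fin N) 0 ∧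
      ϖ ^ m • w ∉ piPrimePowBall (v.adicCompletion F) (Fin N) 1 ×ˢ piPrimePowBall (v.adicCompletion F) (Fin N) 1 := by
  classical
  have hρ0 : (0 : ℝ≥0) < (residueFieldCard (v.adicCompletion F) : ℝ≥0)⁻¹ := inv_residueFieldCard_pos
  have hϖ0 : ϖ ≠ 0 := fun h => by
    rw [h, map_zero] at hϖ
    exact hρ0.ne hϖ
  have hϖpow : ∀ m : ℕ, ϖ ^ m ∈ primePowBall (v.adicCompletion F) (m : ℤ) := fun m => by
    rw [mem_primePowBall_iff, map_pow, hϖ, zpow_natCast]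
  -- some power of `ϖ` moves `w` into the box
  have hex : ∃ m : ℕ, ϖ ^ m • w ∈ piPrimePowBall (v.adicCompletion F) (Fin N) 0 ×ˢ piPrimePowBall (v.adicCompletion F) (Fin N) 0 := by
    obtain ⟨M₁, hM₁⟩ := exists_mem_piPrimePowBall (F := v.adicCompletion F) w.1
    obtain ⟨M₂, hM₂⟩ := exists_mem_piPrimePowBall (F := v.adicCompletion F) w.2
    refine ⟨M₁ + M₂, ?_⟩
    have hw' : w ∈ piPrimePowBall (v.adicCompletion F) (Fin N) (-((M₁ + M₂ : ℕ) : ℤ)) ×ˢ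
        piPrimePowBall (v.adicCompletion F) (Fin N) (-((M₁ + M₂ : ℕ) : ℤ)) :=
      ⟨piPrimePowBall_antitone (by push_cast; omega) hM₁, piPrimePowBall_antitone (by push_cast; omega) hM₂⟩
    have h := smul_mem_box_prod N v (hϖpow (M₁ + M₂)) hw'
    rwa [add_neg_cancel] at h
  refine ⟨Nat.find hex, ?_, Nat.find_spec hex, fun hmem => ?_⟩
  · rcases Nat.eq_zero_or_pos (Nat.find hex) with h0 | hpos
    · have h := Nat.find_spec hex
      rw [h0, pow_zero, one_smul] at h
      exact absurd h hw
    · exact hpos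
  · -- if `ϖ^m w` were in `𝔭ᴺ × 𝔭ᴺ` then `ϖ^{m-1} w ∈ Λ₀`, contradicting minimality
    have hm1 : 1 ≤ Nat.find hex := by
      rcases Nat.eq_zero_or_pos (Nat.find hex) with h0 | hpos
      · have h := Nat.find_spec hex
        rw [h0, pow_zero, one_smul] at h
        exact absurd h hw
      · exact hpos
    have hinv : ϖ⁻¹ ∈ primePowBall (v.adicCompletion F) (-1) := by
      rw [mem_primePowBall_iff, map_inv₀, hϖ, zpow_neg, zpow_one]
    have h := smul_mem_box_prod N v hinv hmem
    have hpow : ϖ⁻¹ * ϖ ^ Nat.find hex = ϖ ^ (Nat.find hex - 1) := by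
      obtain ⟨k, hk⟩ : ∃ k, Nat.find hex = k + 1 := ⟨Nat.find hex - 1, by omega⟩
      rw [hk, pow_succ', ← mul_assoc, inv_mul_cancel₀ hϖ0, one_mul, Nat.add_sub_cancel]
    rw [smul_smul, hpow, show (-1 : ℤ) + 1 = 0 by norm_num] at h
    have hmin := Nat.find_min' hex h
    omega

/-- **EXPANSION OFF THE SELF-DUAL BOX FROM ISOTROPIC ROOT ELEMENTS.**  Let `v ∤ 2` (`½ ∈ 𝒪_v`), `ψ_v` of conductor `𝒪_v`, `𝕋_v` `v`-integral, and
`K ≤ U(J)(F_v)`.  Suppose (ISO): for every PRIMITIVE box vector `u ∈ Λ₀ ∖ (𝔭_vᴺ × 𝔭_vᴺ)` there is an isotropic `r ∈ E_vᴺ` whose root elements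
`n_{bδ}(r)`, `b ∈ 𝒪_v`, lie in `K` (★ `localRootElt`), whose nilpotent `𝔫_r` (★ `localRootNil`) preserves `Λ₀`, and with `A(u, 𝔫_r u) = Nm h(r, u)` a
`v`-UNIT.  Then every `w ∉ Λ₀` is moved by some `k ∈ K` by a box vector with non-trivial Heisenberg phase: writing `w = ϖ^{-m} u` (`m ≥ 1`, `u` primitive),
`k = n_{bδ}(r)` with `b = -2 t₀ ϖ^{2m} ∕ A(u, 𝔫_r u)` (`ψ_v(t₀) ≠ 1`, `t₀ ∈ 𝔭_v^{-1}`) moves `w` by `y = b • 𝔫_r w ∈ Λ₀` with phase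
`½ A(y, w) + ½ B(y, y) = t₀ + ½ B(y, y)`, `½ B(y, y) ∈ 𝒪_v`.  The sharp twin (`Ω = Λ₀`) of ★ `UnitaryGroup.exists_expansion_of_isField`.
[cite: MoeglinVignerasWaldspurger1987, Chap. 2 II.8; Chap. 5 I.4] [cite: Howe1979, §2] -/
theorem expansion_box_of_isotropicRoots
    (h2 : (⅟(2 : v.adicCompletion F) : v.adicCompletion F) ∈ v.adicCompletionIntegers F)
    (hcond : (adeleAddCharAt F v).HasConductorExp 0)
    (hTi : ∀ i j, localGram F N T v i j ∈ primePowBall (v.adicCompletion F) 0)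
    (K : Subgroup (UnitaryGroup.localPi E c N J v))
    (hiso : ∀ u ∈ piPrimePowBall (v.adicCompletion F) (Fin N) 0 ×ˢ piPrimePowBall (v.adicCompletion F) (Fin N) 0,
      u ∉ piPrimePowBall (v.adicCompletion F) (Fin N) 1 ×ˢ piPrimePowBall (v.adicCompletion F) (Fin N) 1 →
      ∃ (r : Fin N → UnitaryGroup.LocalRing E v)
        (hr : hermForm (conjLocal E c v) ((adelicForm E N J).map (adeleToLocal E v)) r r = 0),
        (∀ b ∈ v.adicCompletionIntegers F, localRootElt E c N J v hcδ hδ hJh hr b ∈ K) ∧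
        Set.MapsTo (localRootNil E c N J v hcδ hδ hd r)
          (piPrimePowBall (v.adicCompletion F) (Fin N) 0 ×ˢ piPrimePowBall (v.adicCompletion F) (Fin N) 0)
          (piPrimePowBall (v.adicCompletion F) (Fin N) 0 ×ˢ piPrimePowBall (v.adicCompletion F) (Fin N) 0) ∧
        normAbs (v.adicCompletion F) (alt (polar (localPairing F N T v)) u (localRootNil E c N J v hcδ hδ hd r u)) = 1)
    (w : (Fin N → v.adicCompletion F) × (Fin N → v.adicCompletion F))
    (hw : w ∉ piPrimePowBall (v.adicCompletion F) (Fin N) 0 ×ˢ piPrimePowBall (v.adicCompletion F) (Fin N) 0) :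
    ∃ k ∈ K, ((iota F E c N hcδ hδ hd T hT hJ v k).1 w - w) ∈
        piPrimePowBall (v.adicCompletion F) (Fin N) 0 ×ˢ piPrimePowBall (v.adicCompletion F) (Fin N) 0 ∧
      adeleAddCharAt F v ((ofSymplectic (polar (localPairing F N T v)) (iota F E c N hcδ hδ hd T hT hJ v k)).f w -
        polar (localPairing F N T v) w ((iota F E c N hcδ hδ hd T hT hJ v k).1 w - w)) ≠ 1 := by
  classical
  -- a uniformizer and the primitive scaling `u = ϖ^m • w`
  obtain ⟨π, -, hπ⟩ := exists_coe_valued_eq_exp_neg_one v (K := F)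
  have hϖ := normAbs_eq_inv_of_valued_eq_exp_neg_one v hπ
  generalize hϖdef : ((π : F) : v.adicCompletion F) = ϖ at hϖ
  have hρ0 : (0 : ℝ≥0) < (residueFieldCard (v.adicCompletion F) : ℝ≥0)⁻¹ := inv_residueFieldCard_pos
  have hρ1 : (residueFieldCard (v.adicCompletion F) : ℝ≥0)⁻¹ ≤ 1 := inv_residueFieldCard_lt_one.le
  have hϖ0 : ϖ ≠ 0 := fun h => by
    rw [h, map_zero] at hϖ
    exact hρ0.ne hϖ
  obtain ⟨m, hm1, hu, hu1⟩ := exists_pow_smul_mem_box_primitive N v hϖ w hw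
  generalize hudef : ϖ ^ m • w = u at hu hu1
  have hϖm0 : ϖ ^ m ≠ 0 := pow_ne_zero m hϖ0
  have hwu : w = (ϖ ^ m)⁻¹ • u := by rw [← hudef, smul_smul, inv_mul_cancel₀ hϖm0, one_smul]
  -- the isotropic vector, its root elements in `K`, the integral nilpotent and the unit `ν = A(u, 𝔫 u)`
  obtain ⟨r, hr, hK, hmaps, hunit⟩ := hiso u hu hu1
  generalize hνdef : alt (polar (localPairing F N T v)) u (localRootNil E c N J v hcδ hδ hd r u) = ν at hunit
  have hν0 : ν ≠ 0 := fun h => by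
    rw [h, map_zero] at hunit
    exact zero_ne_one hunit
  -- the test scalar `t₀ ∈ 𝔭⁻¹` with `ψ_v(t₀) ≠ 1`
  obtain ⟨t₀, ht₀, hψt₀⟩ := hcond.2
  rw [zero_sub] at ht₀
  -- the parameter `b = -2 t₀ ϖ^{2m} / ν`
  have h2le : normAbs (v.adicCompletion F) (2 : v.adicCompletion F) ≤ 1 := by
    have h := normAbs_add_le_max (F := v.adicCompletion F) 1 1
    rwa [map_one, max_self, one_add_one_eq_two] at h
  have hb1 : (2 : v.adicCompletion F) * t₀ * ϖ ^ m * ν⁻¹ ∈ primePowBall (v.adicCompletion F) 0 := by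
    rw [mem_primePowBall_iff, map_mul, map_mul, map_mul, map_inv₀, hunit, inv_one, mul_one, map_pow, hϖ, zpow_zero]
    rw [mem_primePowBall_iff] at ht₀
    calc normAbs (v.adicCompletion F) 2 * normAbs (v.adicCompletion F) t₀ * ((residueFieldCard (v.adicCompletion F) : ℝ≥0)⁻¹) ^ m
        ≤ 1 * ((residueFieldCard (v.adicCompletion F) : ℝ≥0)⁻¹) ^ (-1 : ℤ) * ((residueFieldCard (v.adicCompletion F) : ℝ≥0)⁻¹) ^ (1 : ℕ) :=
          mul_le_mul' (mul_le_mul' h2le ht₀) (pow_le_pow_of_le_one hρ0.le hρ1 hm1)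
      _ = 1 := by rw [one_mul, pow_one, zpow_neg, zpow_one, inv_mul_cancel₀ hρ0.ne']
  have hb0 : -((2 : v.adicCompletion F) * t₀ * ϖ ^ m * ν⁻¹ * ϖ ^ m) ∈ v.adicCompletionIntegers F := by
    rw [← mem_primePowBall_zero_iff]
    refine neg_mem_primePowBall ?_
    have h := mul_mem_primePowBall hb1 (show ϖ ^ m ∈ primePowBall (v.adicCompletion F) (m : ℤ) by
      rw [mem_primePowBall_iff, map_pow, hϖ, zpow_natCast])
    exact primePowBall_antitone (by positivity) h
  refine ⟨localRootElt E c N J v hcδ hδ hJh hr (-((2 : v.adicCompletion F) * t₀ * ϖ ^ m * ν⁻¹ * ϖ ^ m)), hK _ hb0, ?_⟩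
  -- the move `y = b • 𝔫 w = -(2 t₀ ϖ^m / ν) • 𝔫 u ∈ Λ₀`
  have hmove : (iota F E c N hcδ hδ hd T hT hJ v
      (localRootElt E c N J v hcδ hδ hJh hr (-((2 : v.adicCompletion F) * t₀ * ϖ ^ m * ν⁻¹ * ϖ ^ m)))).1 w =
        w + (-((2 : v.adicCompletion F) * t₀ * ϖ ^ m * ν⁻¹)) • localRootNil E c N J v hcδ hδ hd r u := by
    rw [iota_localRootElt_apply, hwu, map_smul, smul_smul, neg_mul, mul_assoc _ (ϖ ^ m) (ϖ ^ m)⁻¹, mul_inv_cancel₀ hϖm0, mul_one]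
  have hy : (-((2 : v.adicCompletion F) * t₀ * ϖ ^ m * ν⁻¹)) • localRootNil E c N J v hcδ hδ hd r u ∈
      piPrimePowBall (v.adicCompletion F) (Fin N) 0 ×ˢ piPrimePowBall (v.adicCompletion F) (Fin N) 0 := by
    have h := smul_mem_box_prod N v (neg_mem_primePowBall hb1) (hmaps hu)
    rwa [add_zero] at h
  have hdiff : (iota F E c N hcδ hδ hd T hT hJ v
      (localRootElt E c N J v hcδ hδ hJh hr (-((2 : v.adicCompletion F) * t₀ * ϖ ^ m * ν⁻¹ * ϖ ^ m)))).1 w - w =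
        (-((2 : v.adicCompletion F) * t₀ * ϖ ^ m * ν⁻¹)) • localRootNil E c N J v hcδ hδ hd r u := by
    rw [hmove, add_sub_cancel_left]
  refine ⟨by rw [hdiff]; exact hy, ?_⟩
  -- the phase: `½ A(y, w) + ½ B(y, y) = t₀ + ½ B(y, y)` with `½ B(y, y) ∈ 𝒪_v`
  rw [ofSymplectic_f_sub_eq T v _ w _ hmove]
  have hA : ⅟(2 : v.adicCompletion F) *
      alt (polar (localPairing F N T v)) ((-((2 : v.adicCompletion F) * t₀ * ϖ ^ m * ν⁻¹)) • localRootNil E c N J v hcδ hδ hd r u) w = t₀ := by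
    have hanti : alt (polar (localPairing F N T v)) (localRootNil E c N J v hcδ hδ hd r u) u = -ν := by
      rw [← hνdef, alt_apply, alt_apply, neg_sub]
    have h2ne : (2 : v.adicCompletion F) ≠ 0 := (isUnit_of_invertible (2 : v.adicCompletion F)).ne_zero
    rw [hwu]
    simp only [map_smul, LinearMap.smul_apply, smul_eq_mul]
    rw [hanti, invOf_eq_inv]
    field_simp
  have hB : ⅟(2 : v.adicCompletion F) *
      polar (localPairing F N T v) ((-((2 : v.adicCompletion F) * t₀ * ϖ ^ m * ν⁻¹)) • localRootNil E c N J v hcδ hδ hd r u)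
        ((-((2 : v.adicCompletion F) * t₀ * ϖ ^ m * ν⁻¹)) • localRootNil E c N J v hcδ hδ hd r u) ∈ v.adicCompletionIntegers F := by
    refine mul_mem h2 ?_
    rw [← mem_primePowBall_zero_iff, polar_apply, Matrix.toLinearMap₂'_apply', show (0 : ℤ) = 0 + (0 + 0) by ring]
    refine dotProduct_mem_primePowBall hy.1 ((mem_piPrimePowBall_iff).2 fun i => ?_)
    rw [Matrix.mulVec]
    exact dotProduct_mem_primePowBall ((mem_piPrimePowBall_iff).2 fun l => hTi i l) hy.2
  rw [hA, AddChar.map_add_eq_mul, adeleAddCharAt_eq_one_of_mem F v hB, mul_one]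
  exact hψt₀

end Expansion


/-! ## §4 The line from root data: `ω_v^K = ℂ · 1_{𝒪_vᴺ}` and the θ-factor bound under (ISO) -/

section LineOfRoots

open scoped NNReal
open Literature.NumberTheory.GaloisRepresentations.IsNonarchimedeanLocalField
open Literature.NumberTheory.Automorphic.UnitaryGroup

variable {F : Type} [Field F] [NumberField F] {E : Type} [Field E] [NumberField E] [Algebra F E]
  [Algebra.IsQuadraticExtension F E] {c : E ≃ₐ[F] E} {N : ℕ} {δ : E} {hcδ : c δ = -δ} {hδ : δ ≠ 0} {d : F}
  {hd : δ * δ = algebraMap F E d} {T : Matrix (Fin N) (Fin N) F} {hT : T.IsSymm}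
  {J : Matrix (Fin N) (Fin N) E} {hJ : J = T.map (algebraMap F E)}
  (𝓢 : FinLocalSplittings F E c N hcδ hδ hd T hT hJ) (v : HeightOneSpectrum (𝓞 F))

/-- **(L24-a) FROM ROOT DATA: `ω_v^K = ℂ ∙ 1_{𝒪_vᴺ}`** for a subgroup `K ≤ U(J)(F_v)` fixing `1_{𝒪_vᴺ}` and satisfying (ISO), at a place `v ∤ 2` with `ψ_v` of
conductor `𝒪_v`, `det T` a unit and `𝕋_v` `v`-integral (★ `fixedPoints_omegaLoc_eq_span_unitVec_of_expansion` ∘ `expansion_box_of_isotropicRoots`).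
[cite: MoeglinVignerasWaldspurger1987, Chap. 5 I.4, I.11] [cite: Howe1979, §2] -/
theorem fixedPoints_omegaLoc_eq_span_unitVec_of_isotropicRoots (hTd : IsUnit T.det) (hJh : (J.map c)ᵀ = J)
    (h2 : (⅟(2 : v.adicCompletion F) : v.adicCompletion F) ∈ v.adicCompletionIntegers F)
    (hcond : (adeleAddCharAt F v).HasConductorExp 0)
    (hTi : ∀ i j, localGram F N T v i j ∈ primePowBall (v.adicCompletion F) 0)
    (K : Subgroup (UnitaryGroup.localPi E c N J v))
    (hKφ : ∀ k ∈ K, 𝓢.omegaLoc v k (unitVec F (Fin N) v) = unitVec F (Fin N) v)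
    (hiso : ∀ u ∈ piPrimePowBall (v.adicCompletion F) (Fin N) 0 ×ˢ piPrimePowBall (v.adicCompletion F) (Fin N) 0,
      u ∉ piPrimePowBall (v.adicCompletion F) (Fin N) 1 ×ˢ piPrimePowBall (v.adicCompletion F) (Fin N) 1 →
      ∃ (r : Fin N → UnitaryGroup.LocalRing E v)
        (hr : hermForm (conjLocal E c v) ((adelicForm E N J).map (adeleToLocal E v)) r r = 0),
        (∀ b ∈ v.adicCompletionIntegers F, localRootElt E c N J v hcδ hδ hJh hr b ∈ K) ∧
        Set.MapsTo (localRootNil E c N J v hcδ hδ hd r)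
          (piPrimePowBall (v.adicCompletion F) (Fin N) 0 ×ˢ piPrimePowBall (v.adicCompletion F) (Fin N) 0)
          (piPrimePowBall (v.adicCompletion F) (Fin N) 0 ×ˢ piPrimePowBall (v.adicCompletion F) (Fin N) 0) ∧
        normAbs (v.adicCompletion F) (alt (polar (localPairing F N T v)) u (localRootNil E c N J v hcδ hδ hd r u)) = 1) :
    (𝓢.omegaLoc v).fixedPoints K = ℂ ∙ unitVec F (Fin N) v :=
  fixedPoints_omegaLoc_eq_span_unitVec_of_expansion 𝓢 v hTd hTi K hKφ
    (expansion_box_of_isotropicRoots E c N hcδ hδ hd T hT hJ hJh v h2 hcond hTi K hiso)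

/-- **(L24-a) FOR THE LOCAL θ-FACTOR, FROM ROOT DATA**: under the same hypotheses, for every representation `ρW` of a group `H` on `𝒮(F_vᴺ)` commuting with
`ω_v` (e.g. `ω_v ∘ localCenter`, the centre `U(W)(F_v)`) and every character `χ` of `H`, the `K`-fixed vectors of the `χ`-coinvariants
`TwistedCoinv.rep χ (ω_v) _` lie on the line `ℂ ∙ [1_{𝒪_vᴺ}]`, for every COMPACT `K` (★ `fixedPoints_twistedCoinv_le_span`, `ω_v` is smooth).
[cite: MoeglinVignerasWaldspurger1987, Chap. 3 §IV.4, Chap. 5 I.11] [cite: Liu2021, App. D Lem. D.1 (l. 5226–5233)] -/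
theorem fixedPoints_twistedCoinv_omegaLoc_le_span_of_isotropicRoots (hTd : IsUnit T.det) (hJh : (J.map c)ᵀ = J)
    (h2 : (⅟(2 : v.adicCompletion F) : v.adicCompletion F) ∈ v.adicCompletionIntegers F)
    (hcond : (adeleAddCharAt F v).HasConductorExp 0)
    (hTi : ∀ i j, localGram F N T v i j ∈ primePowBall (v.adicCompletion F) 0)
    (K : Subgroup (UnitaryGroup.localPi E c N J v)) (hKc : IsCompact (K : Set (UnitaryGroup.localPi E c N J v)))
    (hKφ : ∀ k ∈ K, 𝓢.omegaLoc v k (unitVec F (Fin N) v) = unitVec F (Fin N) v)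
    (hiso : ∀ u ∈ piPrimePowBall (v.adicCompletion F) (Fin N) 0 ×ˢ piPrimePowBall (v.adicCompletion F) (Fin N) 0,
      u ∉ piPrimePowBall (v.adicCompletion F) (Fin N) 1 ×ˢ piPrimePowBall (v.adicCompletion F) (Fin N) 1 →
      ∃ (r : Fin N → UnitaryGroup.LocalRing E v)
        (hr : hermForm (conjLocal E c v) ((adelicForm E N J).map (adeleToLocal E v)) r r = 0),
        (∀ b ∈ v.adicCompletionIntegers F, localRootElt E c N J v hcδ hδ hJh hr b ∈ K) ∧
        Set.MapsTo (localRootNil E c N J v hcδ hδ hd r)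
          (piPrimePowBall (v.adicCompletion F) (Fin N) 0 ×ˢ piPrimePowBall (v.adicCompletion F) (Fin N) 0)
          (piPrimePowBall (v.adicCompletion F) (Fin N) 0 ×ˢ piPrimePowBall (v.adicCompletion F) (Fin N) 0) ∧
        normAbs (v.adicCompletion F) (alt (polar (localPairing F N T v)) u (localRootNil E c N J v hcδ hδ hd r u)) = 1)
    {H : Type*} [Group H] {ρW : Representation ℂ H (SchwartzBruhat (Fin N → v.adicCompletion F))} (χ : H →* ℂˣ)
    (hc : ∀ (g : UnitaryGroup.localPi E c N J v) (h : H), Commute (𝓢.omegaLoc v g) (ρW h)) :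
    (Literature.RepresentationTheory.TwistedCoinv.rep χ (𝓢.omegaLoc v) hc).fixedPoints K ≤
      ℂ ∙ Literature.RepresentationTheory.TwistedCoinv.mk ρW χ (unitVec F (Fin N) v) :=
  fixedPoints_twistedCoinv_le_span (𝓢.omegaLoc v) (𝓢.isSmooth_omegaLoc v) χ hc hKc
    (fixedPoints_omegaLoc_eq_span_unitVec_of_isotropicRoots 𝓢 v hTd hJh h2 hcond hTi K hKφ hiso).le

end LineOfRoots

end Summit.HodgeConjecture.HodgeConjecture.Cruxes.HLiu418.K2LiuInertWeilSphericalLine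

end
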